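import Summits.NavierStokesRegularity.FluidComputer.GateBudgetPulseLeak
import Summits.NavierStokesRegularity.FluidComputer.GateBudgetPulseClock
import HarnessLib

/-!
# What no tuning can beat, part 72: THE LEAK FLOOR (iii) — THE DUD CEILING: every rung of the
# clean misfire ladder leaks `ã(T') ≥ ã(r) + 1/K⁹` of output, so ANY run of pulse-separated
# normal-form small-pair ignitions of the lattice family has at most `K⁹/7 + 1` members; against
# the `≍ K⁹/log K` rungs certified from below by the fine ladder (parts 67/69) the clean dud
# horizon is TWO-SIDED, `Θ(K⁹)` up to a logarithm (SPEC-INPUT-bp1 §BE(4)(i), lower side)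

Cell `pub-fluidc`, blueprint seat bp1 (gen 36, first item, file 3 of 3); same namespace and
conventions as parts 1–71 (`GateBudget*.lean`); imports part 71 (`GateBudgetPulseLeak`: §217
`leak_numerics`, `knob_pulse_leak`) and part 61 (`GateBudgetPulseClock`: §190
`knob_pulse_exit`; through it part 52 `GateBudgetPulseStep`: §153 `kept_ring`, §154
`knob_pulse_step`). Independent of parts 63–69 (same ignition data as part 63 §197's rung
successor, which it complements from below). Headline knob family `rotorCircuit K K¹⁰ ε ρ` from
(5.6) (modes `0 = a` carrier, `1 = b` clock, `2 = c` trigger, `3 = d` transfer, `4 = ã` output)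
from `delayInit`, trigger primitive `C` (`C' = c`). HONEST FRAMING (verbatim): low prior, high
value-of-information experiment on Tao's machine paradigm; NOT a claim that NS blows up. Nothing
is proved about the Navier–Stokes equations.

## Why (SPEC-INPUT-bp1 §BE(4)(i); parts 63/64/68 read from the other side)

Part 63 §197 (the rung successor) and part 64 (the ladder) certify, from a normal-form ignition
`b(r) = θε`, `θ ∈ [5/4, 29/20]`, `c(r) = ρ²/K⁹` with small pair `d² + ã² ≤ 1/50`, a misfiring
pulse, a cold phase and a re-ignition in the same normal form, with `√P` growing by at most
`s = 0.3(δ₀ + 1210/K⁸) + 6/K⁹` per rung (fine version, parts 66/67: `1210/K⁸ ↦ 310 log K/K⁹`)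
— whence `≍ 3.3·10⁻⁵K⁸` resp. `≍ 1.3·10⁻⁴K⁹/log K` certified output-free rungs (the pair
budget `0.01194/s`; parts 68/69 in closed form; the clock budget `5·10⁻⁴K⁹` of part 64 is not
the binding one). Those are UPPER bounds on the output per rung (`Δã ≤ 242/K⁸` resp.
`O(log K/K⁹)`, from `d² ≤ 1` over the pulse).
This file books the LOWER bound at the same data: by part 61 §190 the pulse `[r, T']`
(`T' - r ≤ 242/K⁹`) keeps the clock radius and exits through part 52's window, so part 52 §154
pins the dose phase, `|Φ(T') - kπ| ≤ δ(θ², 25/16 - 10⁻⁶) ≤ δ₀ ≤ 1/80` (part 71 §217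
`leak_numerics`, uniform in `θ ∈ [5/4, 3/2]` by antitonicity of part 52's `δ` in the ring
parameter); the energy identity gives `a(r)² + d(r)² = 1 - b² - c² - ã² ≥ 49/50 - 10⁻⁶`; and
part 71's leak law yields `ã(T') - ã(r) ≥ ((49/50 - 10⁻⁶)π/2 - 1/80 - 1/6400)/((3/2 +
1/500)K⁹) - 1/(600K⁹) ≥ 1/K⁹` (§218; margin `≈ 1.4 %`). Since `ã` never decreases, every later
time inherits the rung's output (§218 `knob_rung_leak_after`), and along ANY sequence of such
ignitions separated by at least a pulse length the output climbs by `≥ 1/K⁹` per member while a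
member with `d² + ã² ≤ 1/50` has `ã ≤ 1/7`: at most `K⁹/7 + 1` members (§219). So the clean
misfire ladder of parts 63/64 — whatever the fate of its θ-drift and pair budgets — cannot have
more than `K⁹/7 + 1` rungs: the dud of the lattice family is long (`≍ K⁸ … K⁹/log K` in time,
parts 68/69) but its clean phase is FINITE — between `≍ K⁹/log K` (part 69) and `K⁹/7 + 1`
rungs, `Θ(K⁹)` up to a logarithm.

## What is proved

* §218 `knob_rung_leak` (THE LEAK LAW OF A RUNG): headline member from `delayInit`, trigger
  primitive `C`; `K ≥ 16`, `0 < ε`, `ε² ≤ 1/(6K²⁰)`, `0 < ρ`, `200ε/K²⁰ ≤ ρ²`, `K¹⁰ρ² ≤ 2ε`,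
  `ε = kK¹⁰ρ²`; an ignition `0 ≤ r`, `b(r) = θε`, `5/4 ≤ θ ≤ 3/2`, `c(r) = ρ²/K⁹`,
  `d(r)² + ã(r)² ≤ 1/50` ⇒ `∃ T', r < T' ∧ T' - r ≤ 242/K⁹ ∧ ã(r) + 1/K⁹ ≤ ã(T')`;
  `knob_rung_leak_after`: moreover `ã(r) + 1/K⁹ ≤ ã(t)` for every `t ≥ r + 242/K⁹`.
* §219 `knob_dud_ceiling` (THE DUD CEILING): same member; for `N : ℕ` and times `r : ℕ → ℝ`,
  ratios `θ : ℕ → ℝ` with `0 ≤ r 0`, `r n + 242/K⁹ ≤ r (n+1)` (`n + 1 < N`), and for every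
  `n < N`: `5/4 ≤ θ n ≤ 3/2`, `b(r n) = θ n·ε`, `c(r n) = ρ²/K⁹`, `d(r n)² + ã(r n)² ≤ 1/50`
  ⇒ `(N : ℝ) ≤ K⁹/7 + 1`.

HONEST LIMITS. (i) §219 bounds the NUMBER of clean rungs, not the time to fire: when the bound
is reached one of the hypotheses has failed (the pair exceeds `1/50`, or the clock amplitude has
left `[5/4, 3/2]ε`, or the ignition is no longer in normal form) — NOTHING is claimed about what
the member does afterwards, in particular not that it fires; (ii) the two sides of the clean dud
horizon differ by a factor `≈ 10³·log K` (`≍ 1.3·10⁻⁴K⁹/log K` rungs certified below by parts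
67/69, limited by the fine pair increment `310 log K/K⁹` of part 66 — i.e. by the MISSING
phase-resolved ceiling — vs `K⁹/7` above; against the coarse ladder of parts 64/68,
`≍ 3.3·10⁻⁵K⁸` rungs, the factor is `≍ 4·10³K`); (iii) the floor `1/K⁹` is `≈ 70 %` of the
heuristic per-rung
leak at `k = 1` and ignores its `log k` growth; (iv) headline family `M = K¹⁰`, `K ≥ 16`,
lattice `ε = kK¹⁰ρ²` only; (v) nothing about Navier–Stokes.
[cite: Tao2016AveragedNS, §5.5 Theorem 5.3, (5.5), (5.6), (b-eq), (c-eq), (ta-eq), (energy-con)]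
-/

namespace Summit.NavierStokesRegularity.FluidComputer.GateBudget

open Real Set
open Literature.Analysis.FluidPDE.Tao2016AveragedNS

variable {K ε ρ : ℝ} {X : ℝ → Fin 5 → ℝ} {C : ℝ → ℝ}

/-! ## §218 The leak law of a rung -/

/-- §218 THE LEAK LAW OF A RUNG (SPEC-INPUT-bp1 §BE(4)(i), lower side, at a normal-form ignition).
Headline member from `delayInit` with a trigger primitive `C`, `K ≥ 16`, `0 < ε`,
`ε² ≤ 1/(6K²⁰)`, `0 < ρ`, the lattice window `200ε/K²⁰ ≤ ρ²`, `K¹⁰ρ² ≤ 2ε`, `ε = kK¹⁰ρ²`; an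
ignition `r ≥ 0` in normal form `b(r) = θε`, `5/4 ≤ θ ≤ 3/2`, `c(r) = ρ²/K⁹`, with small output
pair `d(r)² + ã(r)² ≤ 1/50`. Then the pulse of part 61 §190 (`r < T'`, `T' - r ≤ 242/K⁹`) ends
with `ã(T') ≥ ã(r) + 1/K⁹`: A MISFIRING PULSE LEAKS AT LEAST `1/K⁹` OF OUTPUT (its pin, part 52
§154 with the uniform ring `25/16 - 10⁻⁶`, has slip `≤ 1/80` by §217; its entry carrier has
`a(r)² + d(r)² ≥ 49/50 - 10⁻⁶` by the energy identity; §217's leak law then gives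
`≥ ((49/50 - 10⁻⁶)π/2 - 1/80 - 1/6400)/((3/2 + 1/500)K⁹) - 1/(600K⁹) ≥ 1.014/K⁹`).
[derived: part 61 §190, part 52 §153/§154, this file §217; Tao2016AveragedNS (5.6)] -/
theorem knob_rung_leak
    (hX : ∀ t, HasDerivAt X (RotorKnob.rotorCircuit K (K ^ 10) ε ρ (X t)) t)
    (h0 : X 0 = delayInit) (hC : ∀ t, HasDerivAt C (X t 2) t) (hK : 16 ≤ K) (hε : 0 < ε)
    (hεK : ε ^ 2 ≤ 1 / (6 * K ^ 20)) (hρ : 0 < ρ) (hlo : 200 * ε / K ^ 20 ≤ ρ ^ 2)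
    (hhi : K ^ 10 * ρ ^ 2 ≤ 2 * ε) (k : ℕ) (hk : ε = k * K ^ 10 * ρ ^ 2) {r θ : ℝ}
    (hr : 0 ≤ r) (hθ1 : 5 / 4 ≤ θ) (hθ2 : θ ≤ 3 / 2) (hbr : X r 1 = θ * ε)
    (hcr : X r 2 = ρ ^ 2 / K ^ 9) (hPr : X r 3 ^ 2 + X r 4 ^ 2 ≤ 1 / 50) :
    ∃ T' : ℝ, r < T' ∧ T' - r ≤ 242 / K ^ 9 ∧ X r 4 + 1 / K ^ 9 ≤ X T' 4 := by
  have hK0 : (0 : ℝ) < K := by linarith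
  obtain ⟨-, -, -, hδ0, hδ, h243⟩ := leak_numerics hK hε hρ hlo k hk
  -- (1) the pulse (part 61 §190)
  obtain ⟨T', θ₁, hrT, hτ, hcpos, hcT1, -, -, hbT, hθ₁lo, -, hkept, hgrow⟩ :=
    knob_pulse_exit hX h0 hK hε hρ hlo hhi hr hθ1 hθ2 hbr hcr
  have hθ₁1 : 1 ≤ θ₁ := by linarith only [hθ₁lo, hθ1, h243]
  -- (2) the ring and the pin (part 52 §153/§154), uniform `ν₂ = 25/16 - 10⁻⁶`
  have hbr' : 5 / 4 * ε ≤ X r 1 := by rw [hbr]; nlinarith only [hθ1, hε]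
  have hring := kept_ring hε.le (by norm_num : (0 : ℝ) ≤ 5 / 4) hbr' hkept
  have hring' : ∀ t ∈ Icc r T', (25 / 16 - 1 / 10 ^ 6) * ε ^ 2 ≤ X t 1 ^ 2 + X t 2 ^ 2 := by
    intro t ht
    have := hring t ht
    linarith only [this]
  have hbT1 : X T' 1 ≤ -(1 * ε) := by rw [hbT]; nlinarith only [hθ₁1, hε]
  obtain ⟨hpin, -, -, -, -⟩ := knob_pulse_step hX h0 hC hK hε hεK hρ hhi k hk hr
    hrT.le hτ (le_refl _) (le_refl _) (by norm_num) hcpos hcr.le hbr' hbT1 hcT1 hring' hgrow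
  obtain ⟨δ, hδ_def⟩ :
      ∃ δ : ℝ, δ = k * π / ((25 / 16 - 1 / 10 ^ 6) * K ^ 10 - 1) + 1 / K ^ 19 := ⟨_, rfl⟩
  simp only [← hδ_def] at hδ0 hδ hpin
  -- (3) the entry radius `b(r)² + c(r)² ≤ (θ² + 10⁻⁶)ε²`
  have hK10 : (2 : ℝ) ^ 40 ≤ K ^ 10 := by
    calc (2 : ℝ) ^ 40 = 16 ^ 10 := by norm_num
      _ ≤ K ^ 10 := pow_le_pow_left₀ (by norm_num) hK 10
  have hK10pos : (0 : ℝ) < K ^ 10 := by positivity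
  have hK9pos : (0 : ℝ) < K ^ 9 := by positivity
  have hρε : ρ ^ 2 ≤ 2 * ε / K ^ 10 := by
    rw [le_div_iff₀ hK10pos]
    linarith only [hhi]
  have hc1 : ρ ^ 2 / K ^ 9 ≤ ε / 10 ^ 3 := by
    have e1 : ρ ^ 2 / K ^ 9 ≤ ρ ^ 2 :=
      div_le_self (by positivity) (one_le_pow₀ (by linarith only [hK]))
    have e3 : 2 * ε / K ^ 10 ≤ 2 * ε / 2 ^ 40 :=
      div_le_div_of_nonneg_left (by positivity) (by positivity) hK10
    have e4 : 2 * ε / 2 ^ 40 ≤ ε / 10 ^ 3 := by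
      rw [div_le_div_iff₀ (by positivity) (by positivity)]
      linarith only [hε]
    linarith only [e1, hρε, e3, e4]
  have hc2 : (ρ ^ 2 / K ^ 9) ^ 2 ≤ ε ^ 2 / 10 ^ 6 := by
    calc (ρ ^ 2 / K ^ 9) ^ 2 ≤ (ε / 10 ^ 3) ^ 2 := pow_le_pow_left₀ (by positivity) hc1 2
      _ = ε ^ 2 / 10 ^ 6 := by rw [div_pow]; norm_num
  have hbc : X r 1 ^ 2 + X r 2 ^ 2 ≤ (θ ^ 2 + 1 / 10 ^ 6) * ε ^ 2 := by
    rw [hbr, hcr]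
    nlinarith only [hc2]
  -- (4) the leak law of §217
  have hleak := knob_pulse_leak hX h0 hC hK hε hεK hρ hhi k hk hr hrT.le hτ
    (by linarith only [hθ1]) hbc hkept hpin
  -- (5) the entry carrier `a(r)² + d(r)² ≥ 49/50 - 10⁻⁶` and the numerics
  have hbc' : X r 1 ^ 2 + X r 2 ^ 2 ≤ 1 / 10 ^ 6 := by
    refine hbc.trans ?_
    have e1 : (θ ^ 2 + 1 / 10 ^ 6) * ε ^ 2 ≤ (9 / 4 + 1 / 10 ^ 6) * ε ^ 2 :=
      mul_le_mul_of_nonneg_right (by nlinarith only [hθ1, hθ2]) (sq_nonneg ε)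
    have hK20 : (2 : ℝ) ^ 80 ≤ K ^ 20 := by
      calc (2 : ℝ) ^ 80 = 16 ^ 20 := by norm_num
        _ ≤ K ^ 20 := pow_le_pow_left₀ (by norm_num) hK 20
    have e2 : ε ^ 2 ≤ 1 / (6 * 2 ^ 40) :=
      hεK.trans (div_le_div_of_nonneg_left (by norm_num) (by positivity)
        (by linarith only [hK20]))
    nlinarith only [e1, e2]
  have hA : 49 / 50 - 1 / 10 ^ 6 ≤ X r 0 ^ 2 + X r 3 ^ 2 := by
    have hE := RotorKnob.traj_sum_sq_eq_one hX h0 r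
    nlinarith only [hE, hbc', hPr, sq_nonneg (X r 3)]
  have hnum : 1 / K ^ 9 ≤ ((X r 0 ^ 2 + X r 3 ^ 2) * π / 2 - δ - δ ^ 2) / ((θ + 1 / 500) * K ^ 9)
      - 1 / (600 * K ^ 9) := by
    have hpos : 0 < (θ + 1 / 500) * K ^ 9 := by positivity
    have hAπ : (49 / 50 - 1 / 10 ^ 6) * 3.14 ≤ (X r 0 ^ 2 + X r 3 ^ 2) * π :=
      mul_le_mul hA Real.pi_gt_d2.le (by norm_num) (by positivity)
    have hδ2 : δ ^ 2 ≤ δ * (1 / 80) := by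
      rw [sq]
      exact mul_le_mul_of_nonneg_left hδ hδ0
    have key : (1 + 1 / 600) * (θ + 1 / 500)
        ≤ (X r 0 ^ 2 + X r 3 ^ 2) * π / 2 - δ - δ ^ 2 := by
      nlinarith only [hAπ, hδ2, hδ, hδ0, hθ2, hθ1]
    have e1 : (1 + 1 / 600) / K ^ 9 = (1 + 1 / 600) * (θ + 1 / 500) / ((θ + 1 / 500) * K ^ 9) := by
      rw [div_eq_div_iff hK9pos.ne' hpos.ne']
      ring
    have e2 := div_le_div_of_nonneg_right key hpos.le
    rw [← e1] at e2
    have e3 : 1 / K ^ 9 = (1 + 1 / 600) / K ^ 9 - 1 / (600 * K ^ 9) := by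
      rw [eq_sub_iff_add_eq, div_add_div _ _ hK9pos.ne' (by positivity),
        div_eq_div_iff (by positivity) hK9pos.ne']
      ring
    rw [e3]
    linarith only [e2]
  exact ⟨T', hrT, hτ, by linarith only [hleak, hnum]⟩

/-- §218 THE LEAK LAW OF A RUNG, after the pulse: in the setting of `knob_rung_leak`, for every
`t ≥ r + 242/K⁹`, `ã(t) ≥ ã(r) + 1/K⁹` (the output is non-decreasing).
[derived: this file §218; RotorKnob `rotorCircuit_output_monotone`] -/
theorem knob_rung_leak_after
    (hX : ∀ t, HasDerivAt X (RotorKnob.rotorCircuit K (K ^ 10) ε ρ (X t)) t)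
    (h0 : X 0 = delayInit) (hC : ∀ t, HasDerivAt C (X t 2) t) (hK : 16 ≤ K) (hε : 0 < ε)
    (hεK : ε ^ 2 ≤ 1 / (6 * K ^ 20)) (hρ : 0 < ρ) (hlo : 200 * ε / K ^ 20 ≤ ρ ^ 2)
    (hhi : K ^ 10 * ρ ^ 2 ≤ 2 * ε) (k : ℕ) (hk : ε = k * K ^ 10 * ρ ^ 2) {r θ : ℝ}
    (hr : 0 ≤ r) (hθ1 : 5 / 4 ≤ θ) (hθ2 : θ ≤ 3 / 2) (hbr : X r 1 = θ * ε)
    (hcr : X r 2 = ρ ^ 2 / K ^ 9) (hPr : X r 3 ^ 2 + X r 4 ^ 2 ≤ 1 / 50) {t : ℝ}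
    (ht : r + 242 / K ^ 9 ≤ t) : X r 4 + 1 / K ^ 9 ≤ X t 4 := by
  obtain ⟨T', -, hτ, hleak⟩ :=
    knob_rung_leak hX h0 hC hK hε hεK hρ hlo hhi k hk hr hθ1 hθ2 hbr hcr hPr
  have hK0 : (0 : ℝ) ≤ K := by linarith
  have hmono := RotorKnob.rotorCircuit_output_monotone hK0 hX
    (show T' ≤ t by linarith only [hτ, ht])
  exact hleak.trans hmono

/-! ## §219 The dud ceiling: the clean misfire ladder has at most `K⁹/7 + 1` rungs -/

/-! ## §219 The dud ceiling -/

/-- §219 THE DUD CEILING (SPEC-INPUT-bp1 §BE(4)(i): the dud horizon is two-sided). Headline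
member from `delayInit` with a trigger primitive `C`, `K ≥ 16`, `0 < ε`, `ε² ≤ 1/(6K²⁰)`,
`0 < ρ`, `200ε/K²⁰ ≤ ρ²`, `K¹⁰ρ² ≤ 2ε`, `ε = kK¹⁰ρ²`. Let `r₀, r₁, …, r_{N-1}` be ANY times
with `r₀ ≥ 0` and `r_{n+1} ≥ r_n + 242/K⁹`, each a normal-form ignition with small output pair:
`b(r_n) = θ_nε`, `5/4 ≤ θ_n ≤ 3/2`, `c(r_n) = ρ²/K⁹`, `d(r_n)² + ã(r_n)² ≤ 1/50`. Then
`N ≤ K⁹/7 + 1`: by §218 the output climbs `≥ 1/K⁹` from each such ignition to the next, it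
starts `≥ 0` and is `≤ 1/7` at the last one. Against the `≍ K⁹/log K` clean rungs the fine
ladder of parts 67/69 certifies, the clean dud ladder of the lattice family has `Θ(K⁹)` rungs
up to a logarithm — no tuning of `(K, ε, ρ)` inside the headline window makes the misfire
regime last longer than `K⁹/7 + 1` pulses with the output pair below `1/50`; nothing is claimed
about what happens then. [derived: this file §218; Tao2016AveragedNS (5.6)] -/
theorem knob_dud_ceiling
    (hX : ∀ t, HasDerivAt X (RotorKnob.rotorCircuit K (K ^ 10) ε ρ (X t)) t)
    (h0 : X 0 = delayInit) (hC : ∀ t, HasDerivAt C (X t 2) t) (hK : 16 ≤ K) (hε : 0 < ε)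
    (hεK : ε ^ 2 ≤ 1 / (6 * K ^ 20)) (hρ : 0 < ρ) (hlo : 200 * ε / K ^ 20 ≤ ρ ^ 2)
    (hhi : K ^ 10 * ρ ^ 2 ≤ 2 * ε) (k : ℕ) (hk : ε = k * K ^ 10 * ρ ^ 2) {N : ℕ}
    {r θ : ℕ → ℝ} (hr0 : 0 ≤ r 0) (hsep : ∀ n, n + 1 < N → r n + 242 / K ^ 9 ≤ r (n + 1))
    (hθ : ∀ n, n < N → 5 / 4 ≤ θ n ∧ θ n ≤ 3 / 2) (hb : ∀ n, n < N → X (r n) 1 = θ n * ε)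
    (hc : ∀ n, n < N → X (r n) 2 = ρ ^ 2 / K ^ 9)
    (hP : ∀ n, n < N → X (r n) 3 ^ 2 + X (r n) 4 ^ 2 ≤ 1 / 50) :
    (N : ℝ) ≤ K ^ 9 / 7 + 1 := by
  have hK0 : (0 : ℝ) < K := by linarith
  have hK9 : (0 : ℝ) < K ^ 9 := by positivity
  rcases Nat.eq_zero_or_pos N with hN | hN
  · rw [hN, Nat.cast_zero]
    positivity
  have claim : ∀ n, n < N → 0 ≤ r n ∧ X (r 0) 4 + n / K ^ 9 ≤ X (r n) 4 := by
    intro n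
    induction n with
    | zero =>
      intro _
      exact ⟨hr0, by rw [Nat.cast_zero, zero_div, add_zero]⟩
    | succ m ih =>
      intro hm
      have hm' : m < N := Nat.lt_of_succ_lt hm
      obtain ⟨hrm, hout⟩ := ih hm'
      have hs := hsep m hm
      obtain ⟨hθlo, hθhi⟩ := hθ m hm'
      have hleak := knob_rung_leak_after hX h0 hC hK hε hεK hρ hlo hhi k hk hrm hθlo hθhi
        (hb m hm') (hc m hm') (hP m hm') hs
      refine ⟨?_, ?_⟩
      · have : (0 : ℝ) ≤ 242 / K ^ 9 := by positivity
        linarith only [hrm, hs, this]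
      · rw [Nat.cast_succ, add_div]
        linarith only [hout, hleak]
  have hlast : N - 1 < N := Nat.sub_lt hN Nat.one_pos
  obtain ⟨-, hout⟩ := claim (N - 1) hlast
  have he0 : 0 ≤ X (r 0) 4 := RotorKnob.e_nonneg hX h0 hK0.le hr0
  have heN : X (r (N - 1)) 4 ≤ 1 / 7 := by
    have h := hP (N - 1) hlast
    nlinarith only [h, sq_nonneg (X (r (N - 1)) 3), sq_nonneg (X (r (N - 1)) 4 - 1 / 7)]
  have hcast : ((N - 1 : ℕ) : ℝ) = N - 1 := by
    rw [Nat.cast_sub hN, Nat.cast_one]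
  rw [hcast] at hout
  have h1 : ((N : ℝ) - 1) / K ^ 9 ≤ 1 / 7 := by linarith only [hout, he0, heN]
  rw [div_le_iff₀ hK9] at h1
  linarith only [h1]

end Summit.NavierStokesRegularity.FluidComputer.GateBudget
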